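import Mathlib
import Literature.NumberTheory.Transcendental.KZProduct
import Literature.NumberTheory.Transcendental.KZCalculusOver
import Summits.KontsevichZagierPeriods.KontsevichZagierPeriods.Theorems.SoloInformedPeriodRingOver
import Summits.KontsevichZagierPeriods.KontsevichZagierPeriods.Theorems.SoloInformedRealPeriodAlgebra
import Summits.KontsevichZagierPeriods.KontsevichZagierPeriods.Theorems.SoloInformedRealDiscTransfer
import Summits.KontsevichZagierPeriods.KontsevichZagierPeriods.Theorems.SoloInformedRealParamInjective
import HarnessLib

/-!
# Cancellation in `P_ℝ` is `𝔪`-adically invisible: every jet algebra `P_ℝ ⧸ 𝔪ʲ` cancels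

File of the solo-informed residency (s236), sequel of `SoloInformedRealPeriodAlgebra` (the commutative
`ℝ`-algebra `P_ℝ = SoloInformedPeriodRingOver ℝ = KZ_ℝ ⧸ relations ℝ`, `ev : P_ℝ →ₐ[ℝ] ℝ`, and
`Q_ℝ ⟺ ⟦π⟧ ∈ (P_ℝ)⁰`).  Write `𝔪 := ker ev`, a maximal ideal with `P_ℝ = ℝ · 1 ⊕ 𝔪`
(`soloInformedRealValIdeal`).  Because real boxes are SCALARS in `P_ℝ`, an element `u` of non-zero
value `c` is `c · (1 + c⁻¹ y)` with `y = u − c · 1 ∈ 𝔪`, i.e. a unit up to an element of `𝔪`.  Hence,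
by elementary commutative algebra and with no hypothesis:

* `soloInformed_mem_valIdealPow_of_mul_mem` — **every power `𝔪ʲ` is saturated for multiplication by
  elements of non-zero value**: `ev u ≠ 0 → u * m ∈ 𝔪ʲ → m ∈ 𝔪ʲ` (`…_iff`); equivalently every
  element of non-zero value is a non-zero-divisor — indeed a unit, `soloInformed_isUnit_jet_of_evalPOver_ne_zero`
  — of every jet algebra `P_ℝ ⧸ 𝔪ʲ`;
* `soloInformed_mem_iInf_valIdealPow_of_mul_eq_zero` — **all torsion by elements of non-zero value lies
  in `𝔪^∞ := ⨅ⱼ 𝔪ʲ`**: `ev u ≠ 0 → u * m = 0 → m ∈ 𝔪^∞`; sharper, `m ∈ (yʲ)` for every `j`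
  (`soloInformed_mem_span_pow_of_mul_eq_zero`), in particular for `u = ⟦π⟧`, `y = y_π := ⟦π⟧ − π · 1`;
* `soloInformed_mem_nonZeroDivisors_sep_of_evalSep_ne_zero` — **in the separated quotient
  `P_ℝ ⧸ 𝔪^∞` every element of non-zero value is a non-zero-divisor**, unconditionally
  (`ev` descends to `soloInformedEvalSep`);
* `soloInformed_mem_nonZeroDivisors_of_iInf_valIdealPow_eq_bot` — **Krull separation ⇒ full real
  cancellation**: if `⨅ⱼ 𝔪ʲ = ⊥` (equivalently `IsHausdorff 𝔪 P_ℝ`,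
  `soloInformed_mem_nonZeroDivisors_of_isHausdorff`) then EVERY element of `P_ℝ` of non-zero value is a
  non-zero-divisor; in particular `Q_ℝ` (`soloInformed_piCancellationReal_of_iInf_valIdealPow_eq_bot`),
  hence — conditional on the Lion–Rolin preparation fact, through THEOREM T of the residency —
  `KZ.PiCancellation` (`soloInformed_piCancellation_of_iInf_valIdealPow_eq_bot_prep`) and cancellation
  by every non-zero-valued element of the `ℚ`-data ring `SoloInformedPeriodRingOver ℚ`
  (`soloInformed_mem_nonZeroDivisors_rat_of_iInf_valIdealPow_eq_bot_prep`).

Reading (kernel form of `paper/real-parameters.md` (S3)/(Q3), sharpened from "`y_π`-divisible" to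
"`𝔪`-adically infinitely divisible, for every multiplier of non-zero value, at every jet level"): a
failure of the cancellation conjunct (2) of Kontsevich–Zagier's Conjecture 1 with real coefficients is
invisible to every `𝔪`-adic jet `P_ℝ ⧸ 𝔪ʲ` — any invariant of real formal periods that factors through
a jet kills all witnesses — while conversely a proof that the jets separate `P_ℝ` (Krull's intersection
property at `𝔪 = ker ev`; `P_ℝ` is not known to be Noetherian, so Krull's theorem does not apply) would
prove (2).  Nothing here decides `Q_ℝ` or `KZ.PiCancellation` (both OPEN); the trick needs `ev u ∈ ℝ`
to be a scalar of the ring and has no analogue in `P_ℚ` (`π ∉ ℚ`).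

References: M. Kontsevich, D. Zagier, *Periods* (2001), §1.2, §4.1; W. Krull's intersection
theorem in the form of Mathlib's `IsHausdorff` (`Mathlib.RingTheory.AdicCompletion.Basic`).
-/

noncomputable section

open scoped nonZeroDivisors
open Literature.ModelTheory.ExponentialFields Literature.NumberTheory.Transcendental

namespace Summit.KontsevichZagierPeriods.KontsevichZagierPeriods.Theorems

/-! ### The value ideal `𝔪 = ker ev` and the scalar decomposition -/

/-- **`𝔪 := ker ev`**, the ideal of real formal periods of value `0` (maximal:
`soloInformed_ker_evalPOver_real_isMaximal`). -/
def soloInformedRealValIdeal : Ideal (SoloInformedPeriodRingOver ℝ) :=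
  RingHom.ker (soloInformedEvalPOver ℝ)

/-- Membership in `𝔪` is vanishing of the value. -/
theorem soloInformed_mem_realValIdeal_iff {x : SoloInformedPeriodRingOver ℝ} :
    x ∈ soloInformedRealValIdeal ↔ soloInformedEvalPOver ℝ x = 0 := RingHom.mem_ker

/-- `𝔪` is a maximal ideal. -/
theorem soloInformed_realValIdeal_isMaximal : soloInformedRealValIdeal.IsMaximal :=
  soloInformed_ker_evalPOver_real_isMaximal

/-- **The defect `y_u := u − ev(u) · 1`** of a real formal period. -/
def soloInformedRealDefect (u : SoloInformedPeriodRingOver ℝ) : SoloInformedPeriodRingOver ℝ :=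
  u - algebraMap ℝ (SoloInformedPeriodRingOver ℝ) (soloInformedEvalPOver ℝ u)

/-- The defect has value `0`: `y_u ∈ 𝔪`. -/
theorem soloInformed_realDefect_mem (u : SoloInformedPeriodRingOver ℝ) :
    soloInformedRealDefect u ∈ soloInformedRealValIdeal :=
  soloInformed_sub_algebraMap_evalPOver_mem_ker u

/-- `u = ev(u) · 1 + y_u`. -/
theorem soloInformed_eq_algebraMap_add_realDefect (u : SoloInformedPeriodRingOver ℝ) :
    u = algebraMap ℝ (SoloInformedPeriodRingOver ℝ) (soloInformedEvalPOver ℝ u) +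
      soloInformedRealDefect u := by
  rw [soloInformedRealDefect, add_sub_cancel]

/-- **Scalar extraction**: `u * m = ev(u) • m + y_u * m`. -/
theorem soloInformed_mul_eq_smul_add_realDefect_mul (u m : SoloInformedPeriodRingOver ℝ) :
    u * m = soloInformedEvalPOver ℝ u • m + soloInformedRealDefect u * m := by
  rw [Algebra.smul_def, soloInformedRealDefect, sub_mul, add_sub_cancel]

/-- Inverting a non-zero scalar: `m = c⁻¹ • (c • m)`. -/
theorem soloInformed_eq_inv_smul_smul {c : ℝ} (hc : c ≠ 0) (m : SoloInformedPeriodRingOver ℝ) :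
    m = c⁻¹ • (c • m) := by
  rw [smul_smul, inv_mul_cancel₀ hc, one_smul]

/-! ### Every power of `𝔪` is saturated for multipliers of non-zero value -/

/-- **Saturation of `𝔪ʲ`.** If `ev u ≠ 0` and `u * m ∈ 𝔪ʲ` then `m ∈ 𝔪ʲ`: by induction on the level,
`ev(u) • m = u * m − y_u * m ∈ 𝔪ⁱ⁺¹` as soon as `m ∈ 𝔪ⁱ` (`y_u ∈ 𝔪`), and `ev(u)` is an invertible
scalar. -/
theorem soloInformed_mem_valIdealPow_of_mul_mem {u m : SoloInformedPeriodRingOver ℝ}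
    (hu : soloInformedEvalPOver ℝ u ≠ 0) {j : ℕ}
    (h : u * m ∈ soloInformedRealValIdeal ^ j) : m ∈ soloInformedRealValIdeal ^ j := by
  suffices H : ∀ i, i ≤ j → m ∈ soloInformedRealValIdeal ^ i from H j le_rfl
  intro i
  induction i with
  | zero =>
    intro _
    rw [pow_zero, Ideal.one_eq_top]
    exact Submodule.mem_top
  | succ i ih =>
    intro hi
    have hm : m ∈ soloInformedRealValIdeal ^ i := ih (Nat.le_of_succ_le hi)
    have h1 : soloInformedRealDefect u * m ∈ soloInformedRealValIdeal ^ (i + 1) := by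
      rw [pow_succ']
      exact Ideal.mul_mem_mul (soloInformed_realDefect_mem u) hm
    have h2 : u * m ∈ soloInformedRealValIdeal ^ (i + 1) := Ideal.pow_le_pow_right hi h
    have h3 : soloInformedEvalPOver ℝ u • m ∈ soloInformedRealValIdeal ^ (i + 1) := by
      have h4 := sub_mem h2 h1
      rwa [soloInformed_mul_eq_smul_add_realDefect_mul, add_sub_cancel_right] at h4
    rw [soloInformed_eq_inv_smul_smul hu m, Algebra.smul_def]
    exact Ideal.mul_mem_left _ _ h3

/-- **`u * m ∈ 𝔪ʲ ↔ m ∈ 𝔪ʲ`** for `ev u ≠ 0`: elements of non-zero value are non-zero-divisors of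
every jet algebra `P_ℝ ⧸ 𝔪ʲ`. -/
theorem soloInformed_mul_mem_valIdealPow_iff {u : SoloInformedPeriodRingOver ℝ}
    (hu : soloInformedEvalPOver ℝ u ≠ 0) (m : SoloInformedPeriodRingOver ℝ) (j : ℕ) :
    u * m ∈ soloInformedRealValIdeal ^ j ↔ m ∈ soloInformedRealValIdeal ^ j :=
  ⟨soloInformed_mem_valIdealPow_of_mul_mem hu, fun h => Ideal.mul_mem_left _ _ h⟩

/-- **Units in the jets.** An element of non-zero value `c` is a UNIT of every jet algebra
`P_ℝ ⧸ 𝔪ʲ`: there it is `c · 1 +` a nilpotent (`y_u ^ j ∈ 𝔪ʲ`). -/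
theorem soloInformed_isUnit_jet_of_evalPOver_ne_zero {u : SoloInformedPeriodRingOver ℝ}
    (hu : soloInformedEvalPOver ℝ u ≠ 0) (j : ℕ) :
    IsUnit (Ideal.Quotient.mk (soloInformedRealValIdeal ^ j) u) := by
  have hnil : IsNilpotent (Ideal.Quotient.mk (soloInformedRealValIdeal ^ j)
      (soloInformedRealDefect u)) := by
    refine ⟨j, ?_⟩
    rw [← map_pow, Ideal.Quotient.eq_zero_iff_mem]
    exact Ideal.pow_mem_pow (soloInformed_realDefect_mem u) j
  have hunit : IsUnit (Ideal.Quotient.mk (soloInformedRealValIdeal ^ j)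
      (algebraMap ℝ (SoloInformedPeriodRingOver ℝ) (soloInformedEvalPOver ℝ u))) :=
    ((IsUnit.mk0 _ hu).map (algebraMap ℝ (SoloInformedPeriodRingOver ℝ))).map _
  have h := hnil.isUnit_add_left_of_commute hunit (Commute.all _ _)
  rwa [← map_add, ← soloInformed_eq_algebraMap_add_realDefect] at h

/-! ### Torsion is `𝔪`-adically infinitely divisible -/

/-- **Torsion lies in every power of `𝔪`.** If `ev u ≠ 0` and `u * m = 0` then `m ∈ 𝔪ʲ` for all
`j`. -/
theorem soloInformed_mem_valIdealPow_of_mul_eq_zero {u m : SoloInformedPeriodRingOver ℝ}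
    (hu : soloInformedEvalPOver ℝ u ≠ 0) (h : u * m = 0) (j : ℕ) :
    m ∈ soloInformedRealValIdeal ^ j :=
  soloInformed_mem_valIdealPow_of_mul_mem hu (h ▸ Submodule.zero_mem _)

/-- **`𝔪^∞ := ⨅ⱼ 𝔪ʲ`**, the ideal of `𝔪`-adically invisible real formal periods. -/
def soloInformedRealValIdealInfty : Ideal (SoloInformedPeriodRingOver ℝ) :=
  ⨅ j : ℕ, soloInformedRealValIdeal ^ j

/-- Membership in `𝔪^∞`. -/
theorem soloInformed_mem_realValIdealInfty_iff {m : SoloInformedPeriodRingOver ℝ} :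
    m ∈ soloInformedRealValIdealInfty ↔ ∀ j : ℕ, m ∈ soloInformedRealValIdeal ^ j :=
  Submodule.mem_iInf _

/-- `𝔪^∞ ≤ 𝔪`. -/
theorem soloInformed_realValIdealInfty_le : soloInformedRealValIdealInfty ≤ soloInformedRealValIdeal :=
  fun m hm => by
    have h := (soloInformed_mem_realValIdealInfty_iff.mp hm) 1
    rwa [pow_one] at h

/-- **All torsion by elements of non-zero value lies in `𝔪^∞`.** -/
theorem soloInformed_mem_iInf_valIdealPow_of_mul_eq_zero {u m : SoloInformedPeriodRingOver ℝ}
    (hu : soloInformedEvalPOver ℝ u ≠ 0) (h : u * m = 0) : m ∈ soloInformedRealValIdealInfty :=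
  soloInformed_mem_realValIdealInfty_iff.mpr (soloInformed_mem_valIdealPow_of_mul_eq_zero hu h)

/-- **`𝔪^∞` is saturated** for multipliers of non-zero value. -/
theorem soloInformed_mul_mem_realValIdealInfty_iff {u : SoloInformedPeriodRingOver ℝ}
    (hu : soloInformedEvalPOver ℝ u ≠ 0) (m : SoloInformedPeriodRingOver ℝ) :
    u * m ∈ soloInformedRealValIdealInfty ↔ m ∈ soloInformedRealValIdealInfty := by
  simp only [soloInformed_mem_realValIdealInfty_iff, soloInformed_mul_mem_valIdealPow_iff hu]

/-- **Sharper divisibility: `m ∈ (y_uʲ)` for every `j`.** If `ev u = c ≠ 0` and `u * m = 0` then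
`m = (−c⁻¹)ʲ • (y_uʲ * m)` for all `j`. -/
theorem soloInformed_eq_pow_smul_realDefect_pow_mul {u m : SoloInformedPeriodRingOver ℝ}
    (hu : soloInformedEvalPOver ℝ u ≠ 0) (h : u * m = 0) (j : ℕ) :
    m = (-(soloInformedEvalPOver ℝ u)⁻¹) ^ j • (soloInformedRealDefect u ^ j * m) := by
  -- one step: `m = −c⁻¹ • (y_u * m)`
  have h0 : soloInformedEvalPOver ℝ u • m = -(soloInformedRealDefect u * m) := by
    rw [eq_neg_iff_add_eq_zero, ← soloInformed_mul_eq_smul_add_realDefect_mul, h]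
  have h1 : m = (-(soloInformedEvalPOver ℝ u)⁻¹) • (soloInformedRealDefect u * m) :=
    calc m = (soloInformedEvalPOver ℝ u)⁻¹ • (soloInformedEvalPOver ℝ u • m) :=
          soloInformed_eq_inv_smul_smul hu m
      _ = (-(soloInformedEvalPOver ℝ u)⁻¹) • (soloInformedRealDefect u * m) := by
          rw [h0, smul_neg, neg_smul]
  induction j with
  | zero => rw [pow_zero, pow_zero, one_mul, one_smul]
  | succ j ih =>
    conv_lhs => rw [ih, h1, mul_smul_comm, ← mul_assoc, ← pow_succ, smul_smul, ← pow_succ]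

/-- **`m ∈ Ideal.span {y_u ^ j}` for every `j`** (`ev u ≠ 0`, `u * m = 0`). -/
theorem soloInformed_mem_span_pow_of_mul_eq_zero {u m : SoloInformedPeriodRingOver ℝ}
    (hu : soloInformedEvalPOver ℝ u ≠ 0) (h : u * m = 0) (j : ℕ) :
    m ∈ Ideal.span {soloInformedRealDefect u ^ j} := by
  rw [soloInformed_eq_pow_smul_realDefect_pow_mul hu h j, Algebra.smul_def]
  exact Ideal.mul_mem_left _ _ (Ideal.mul_mem_right _ _ (Ideal.mem_span_singleton_self _))

/-- **The `⟦π⟧` instance** (`y_π := ⟦π⟧ − π · 1`): a witness against `Q_ℝ` — `⟦π⟧ * m = 0` — is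
divisible by every power of `y_π` and lies in `𝔪^∞`. -/
theorem soloInformed_piTorsion_mem_span_pow_and_infty {m : SoloInformedPeriodRingOver ℝ}
    (h : soloInformedPiClassReal * m = 0) :
    (∀ j : ℕ, m ∈ Ideal.span {soloInformedRealDefect soloInformedPiClassReal ^ j}) ∧
      m ∈ soloInformedRealValIdealInfty := by
  have hu : soloInformedEvalPOver ℝ soloInformedPiClassReal ≠ 0 := by
    rw [soloInformed_evalPOver_piClassReal]; exact Real.pi_ne_zero
  exact ⟨soloInformed_mem_span_pow_of_mul_eq_zero hu h,
    soloInformed_mem_iInf_valIdealPow_of_mul_eq_zero hu h⟩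

/-! ### The separated quotient `P_ℝ ⧸ 𝔪^∞` cancels, unconditionally -/

/-- **`ev` descends to the separated quotient** `P_ℝ ⧸ 𝔪^∞` (`𝔪^∞ ≤ 𝔪 = ker ev`). -/
def soloInformedEvalSep : SoloInformedPeriodRingOver ℝ ⧸ soloInformedRealValIdealInfty →+* ℝ :=
  Ideal.Quotient.lift _ (soloInformedEvalPOver ℝ) fun _ hm =>
    soloInformed_mem_realValIdeal_iff.mp (soloInformed_realValIdealInfty_le hm)

/-- `evSep ⟦x⟧ = ev x`. -/
@[simp] theorem soloInformed_evalSep_mk (x : SoloInformedPeriodRingOver ℝ) :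
    soloInformedEvalSep (Ideal.Quotient.mk soloInformedRealValIdealInfty x) =
      soloInformedEvalPOver ℝ x :=
  Ideal.Quotient.lift_mk _ _ _

/-- **Full cancellation holds in `P_ℝ ⧸ 𝔪^∞`, with no hypothesis**: every element of non-zero value
is a non-zero-divisor of the separated quotient. -/
theorem soloInformed_mem_nonZeroDivisors_sep_of_evalSep_ne_zero
    {x : SoloInformedPeriodRingOver ℝ ⧸ soloInformedRealValIdealInfty}
    (hx : soloInformedEvalSep x ≠ 0) :
    x ∈ (SoloInformedPeriodRingOver ℝ ⧸ soloInformedRealValIdealInfty)⁰ := by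
  obtain ⟨u, rfl⟩ := Ideal.Quotient.mk_surjective x
  rw [soloInformed_evalSep_mk] at hx
  refine mem_nonZeroDivisors_iff_left.mpr fun y hy => ?_
  obtain ⟨m, rfl⟩ := Ideal.Quotient.mk_surjective y
  rw [← map_mul, Ideal.Quotient.eq_zero_iff_mem] at hy
  exact Ideal.Quotient.eq_zero_iff_mem.mpr ((soloInformed_mul_mem_realValIdealInfty_iff hx m).mp hy)

/-! ### Krull separation at `𝔪` implies the whole real cancellation conjunct -/

/-- **Krull separation ⇒ full real cancellation.** If `⨅ⱼ 𝔪ʲ = ⊥` in `P_ℝ` then every real formal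
period of non-zero value is a non-zero-divisor of `P_ℝ`. -/
theorem soloInformed_mem_nonZeroDivisors_of_iInf_valIdealPow_eq_bot
    (hsep : soloInformedRealValIdealInfty = ⊥) {u : SoloInformedPeriodRingOver ℝ}
    (hu : soloInformedEvalPOver ℝ u ≠ 0) : u ∈ (SoloInformedPeriodRingOver ℝ)⁰ :=
  mem_nonZeroDivisors_iff_left.mpr fun m hm => by
    have h := soloInformed_mem_iInf_valIdealPow_of_mul_eq_zero hu hm
    rwa [hsep, Ideal.mem_bot] at h

/-- The same from Mathlib's `IsHausdorff 𝔪 P_ℝ` (`𝔪`-adic separation). -/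
theorem soloInformed_realValIdealInfty_eq_bot_of_isHausdorff
    (h : IsHausdorff soloInformedRealValIdeal (SoloInformedPeriodRingOver ℝ)) :
    soloInformedRealValIdealInfty = ⊥ := by
  have h1 := h.iInf_pow_smul
  simp only [Ideal.smul_eq_mul, Ideal.mul_top] at h1
  exact h1

/-- **`IsHausdorff 𝔪 P_ℝ` ⇒ every element of non-zero value is a non-zero-divisor.** -/
theorem soloInformed_mem_nonZeroDivisors_of_isHausdorff
    (h : IsHausdorff soloInformedRealValIdeal (SoloInformedPeriodRingOver ℝ))
    {u : SoloInformedPeriodRingOver ℝ} (hu : soloInformedEvalPOver ℝ u ≠ 0) :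
    u ∈ (SoloInformedPeriodRingOver ℝ)⁰ :=
  soloInformed_mem_nonZeroDivisors_of_iInf_valIdealPow_eq_bot
    (soloInformed_realValIdealInfty_eq_bot_of_isHausdorff h) hu

/-- **Krull separation ⇒ `Q_ℝ`** (`⟦π⟧` is a non-zero-divisor of `P_ℝ`). -/
theorem soloInformed_piCancellationReal_of_iInf_valIdealPow_eq_bot
    (hsep : soloInformedRealValIdealInfty = ⊥) : SoloInformedPiCancellationReal :=
  soloInformed_piCancellationReal_iff_mem_nonZeroDivisors.mpr
    (soloInformed_mem_nonZeroDivisors_of_iInf_valIdealPow_eq_bot hsep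
      (by rw [soloInformed_evalPOver_piClassReal]; exact Real.pi_ne_zero))

/-- **(SEP) form**: already `⨅ⱼ (y_πʲ) = ⊥` gives `Q_ℝ`. -/
theorem soloInformed_piCancellationReal_of_iInf_span_pow_eq_bot
    (hsep : (⨅ j : ℕ, Ideal.span {soloInformedRealDefect soloInformedPiClassReal ^ j}) = ⊥) :
    SoloInformedPiCancellationReal := by
  refine soloInformed_piCancellationReal_iff_forall_mul_eq_zero.mpr fun m hm => ?_
  have h : m ∈ ⨅ j : ℕ, Ideal.span {soloInformedRealDefect soloInformedPiClassReal ^ j} :=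
    (Submodule.mem_iInf _).mpr (soloInformed_piTorsion_mem_span_pow_and_infty hm).1
  rwa [hsep, Ideal.mem_bot] at h

/-- **Krull separation of `P_ℝ` ⇒ `KZ.PiCancellation`**, conditional on the preparation fact
(THEOREM T of the residency: `PiCanc_ℝ ⇒ PiCanc_ℚ`). -/
theorem soloInformed_piCancellation_of_iInf_valIdealPow_eq_bot_prep
    (hprep : semialgebraicPreparation) (hsep : soloInformedRealValIdealInfty = ⊥) :
    KZ.PiCancellation :=
  soloInformed_piCancellation_of_real_prep hprep
    (soloInformed_piCancellationReal_of_iInf_valIdealPow_eq_bot hsep)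

/-- **Krull separation of `P_ℝ` ⇒ cancellation by every non-zero-valued element of the `ℚ`-data
ring `P_ℚ = SoloInformedPeriodRingOver ℚ`**, conditional on the preparation fact (pull back along the
injective ring map `P_ℚ →+* P_ℝ`, which preserves values). -/
theorem soloInformed_mem_nonZeroDivisors_rat_of_iInf_valIdealPow_eq_bot_prep
    (hprep : semialgebraicPreparation) (hsep : soloInformedRealValIdealInfty = ⊥)
    {p : SoloInformedPeriodRingOver ℚ} (hp : soloInformedEvalPOver ℚ p ≠ 0) :
    p ∈ (SoloInformedPeriodRingOver ℚ)⁰ := by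
  refine mem_nonZeroDivisors_iff_left.mpr fun q hq => ?_
  have hu : soloInformedEvalPOver ℝ (soloInformedPeriodRingBaseChange ℚ ℝ p) ≠ 0 := by
    rwa [soloInformed_evalPOver_baseChange]
  have h0 : soloInformedPeriodRingBaseChange ℚ ℝ p * soloInformedPeriodRingBaseChange ℚ ℝ q = 0 := by
    rw [← map_mul, hq, map_zero]
  have hq0 : soloInformedPeriodRingBaseChange ℚ ℝ q = 0 :=
    (mem_nonZeroDivisors_iff_left.mp
      (soloInformed_mem_nonZeroDivisors_of_iInf_valIdealPow_eq_bot hsep hu)) _ h0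
  exact soloInformed_periodRingBaseChange_rat_real_injective_prep hprep (by rw [hq0, map_zero])

end Summit.KontsevichZagierPeriods.KontsevichZagierPeriods.Theorems
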